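import Summits.CriticalPhenomena.SAWScalingLimit.Theorems.SAWLoopFugacityFlowAvoidanceLimitAnchorDefs
import Summits.CriticalPhenomena.SAWScalingLimit.Theorems.SAWLoopFugacityFlowAvoidanceLimitSawEndpoint
import Literature.Probability.LatticeModels.DiluteLoopModelAnalyticity

/-!
# Response of the SAW two-leg function to the edge fugacity at `n = 0` —
helper of the lever `stub_cornerLipschitz` of line `saw-corner-germ`
(crux `SAWLoopFugacityFlow.AvoidanceLimit`, stmt-CriticalPhenomena-10649)

The second finite-volume identity behind the corner lever (the lead's assessment §1, the `ℓ|γ|` term of the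
compensated contact functional): at `n = 0` the normalised two-leg function of the Anchor family on a subgraph
`H ≤ ℤ²` is the self-avoiding-path generating function `Σ_γ x^{|γ|}` (`Anchor.twoLegDim_zero_zero_eq_sum_paths`),
so its derivative in the EDGE fugacity is `Σ_γ |γ| x^{|γ|-1}` (`hasDerivAt_twoLegDim_zero_zero_fugacity`), i.e.
`x ∂ₓ log twoLeg = E^γ[|γ|]`, the mean length under the law `∝ x^{|γ|}` — the quantity that the motion of the
critical curve `x = critLine n` multiplies in `d/dn log R_δ(n)` (chain rule), and the one that diverges like
`δ^{-4/3}` in a domain of mesh `δ` at `x = x_c`.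

Sources: N. Madras, G. Slade, *The Self-Avoiding Walk* (1993), §1.2–§1.3 (two-point function, mean length as a
logarithmic derivative) [MadrasSlade1993]. No new definitions; nothing about the scaling limit is asserted here.
-/

noncomputable section

open Finset
open scoped symmDiff
open Literature.Probability.RandomPlanarGeometry Literature.Probability.LatticeModels
open Summit.CriticalPhenomena.SAWScalingLimit.Theorems.AvoidanceLimit.Anchor

namespace Summit.CriticalPhenomena.SAWScalingLimit.Theorems.AvoidanceLimit.Corner

/-- **Edge-fugacity response of the SAW two-leg function** (`n = t = 0`, subgraph of `ℤ²`, `a ≠ b`):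
`∂ₓ Σ_γ x^{|γ|} = Σ_γ |γ| x^{|γ|-1}`. [cite: MadrasSlade1993, §1.3 (mean length as x d/dx log of the generating function)] -/
theorem hasDerivAt_twoLegDim_zero_zero_fugacity :
    ∀ (H : SimpleGraph (Site 2)) [H.LocallyFinite], H ≤ zdGraph 2 →
      ∀ (Λ : Finset (Site 2)) (a b : Site 2), a ≠ b → ∀ x : ℝ,
        HasDerivAt (fun y : ℝ => twoLegDim (0 : ℝ) 0 y H Λ a b)
          (∑ p ∈ DiluteLoopModel.pathsIn H Λ a b, (p.length : ℝ) * x ^ (p.length - 1)) x := by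
  intro H _ hH Λ a b hab x
  have hfun : (fun y : ℝ => twoLegDim (0 : ℝ) 0 y H Λ a b) =
      fun y : ℝ => ∑ p ∈ DiluteLoopModel.pathsIn H Λ a b, y ^ p.length :=
    funext fun y => twoLegDim_zero_zero_eq_sum_paths hH y Λ hab
  rw [hfun]
  exact HasDerivAt.fun_sum fun p _ => hasDerivAt_pow p.length x

/-- **Mean length as a logarithmic derivative** (`n = t = 0`): where the path generating function is positive,
`∂ₓ log twoLeg(x) = (Σ_γ |γ| x^{|γ|-1}) / (Σ_γ x^{|γ|})`, i.e. `x ∂ₓ log twoLeg = E^γ_x[|γ|]`.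
[cite: MadrasSlade1993, §1.3] -/
theorem hasDerivAt_log_twoLegDim_zero_zero_fugacity :
    ∀ (H : SimpleGraph (Site 2)) [H.LocallyFinite], H ≤ zdGraph 2 →
      ∀ (Λ : Finset (Site 2)) (a b : Site 2), a ≠ b → ∀ x : ℝ,
        0 < ∑ p ∈ DiluteLoopModel.pathsIn H Λ a b, x ^ p.length →
        HasDerivAt (fun y : ℝ => Real.log (twoLegDim (0 : ℝ) 0 y H Λ a b))
          ((∑ p ∈ DiluteLoopModel.pathsIn H Λ a b, (p.length : ℝ) * x ^ (p.length - 1)) /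
            ∑ p ∈ DiluteLoopModel.pathsIn H Λ a b, x ^ p.length) x := by
  intro H _ hH Λ a b hab x hpos
  have hd := hasDerivAt_twoLegDim_zero_zero_fugacity H hH Λ a b hab x
  have hval : twoLegDim (0 : ℝ) 0 x H Λ a b = ∑ p ∈ DiluteLoopModel.pathsIn H Λ a b, x ^ p.length :=
    twoLegDim_zero_zero_eq_sum_paths hH x Λ hab
  have hne : twoLegDim (0 : ℝ) 0 x H Λ a b ≠ 0 := by rw [hval]; exact hpos.ne'
  have hlog := HasDerivAt.log hd hne
  rw [hval] at hlog
  exact hlog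

end Summit.CriticalPhenomena.SAWScalingLimit.Theorems.AvoidanceLimit.Corner

end
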